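import Summits.ResolutionOfSingularities.ResolutionOfSingularities.Theorems.EquisingularLiftEquisingularLiftNatSubchainSupplierInvSZeroDefs
import Summits.ResolutionOfSingularities.ResolutionOfSingularities.Theorems.EquisingularLiftEquisingularLiftNatSubchainSupplierInvSLDefs
import HarnessLib

/-!
# [OURS · L1 W4.5(b) · EL♮(3) · T23-A‴ (U6), SHADOW-FREE ARM] `TCPlus.MemberS₀At` / `TCPlus.MemberS₀L` / `TCPlus.InvS₀L` — the shadow-free inner
# invariant (res-type-027's R-b arm `TCPlus.MemberS₀`/`InvS₀`, …NatSubchainSupplierInvSZeroDefs p620119) at an EXPLICIT stage and with the LIST OF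
# MODEL-CARRYING IN-CARRIER PLANES `Ls` (`TCPlus.LetterDatum`, …NatSubchainSupplierInvSLDefs p626460) in the SAME stage
# (res-L1-w45b-stub-4's request 2026-08-28T11:24:07Z: the producer may take `K₂ = ∅` and still seed `Es₁₀` with planes ⇒ the plane list is needed in BOTH arms)

res-type-027 g18 ((U6) owner), DEFINITIONS (G0; `--kind definition`, helper lane). OURS; NOT a statement of any manuscript ([Hironaka2017] is a
candidate under adjudication, nothing of it is asserted); AI-written, weaker than expert review. No `sorry`; standard axioms; no instances, no notation.
`MemberS₀At` = the body of `MemberS₀` VERBATIM at an explicit stage (so `MemberS₀ … ↔ ∃ stage, MemberS₀At …` is `Iff.rfl`); `MemberS₀L … Ls excl :=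
∃ stage, MemberS₀At … ∧ ∀ L ∈ Ls, LetterDatum …`; `InvS₀L W G β T Z S_d Ls b` = `InvS₀` with `MemberS₀L` in both member clauses; pure-logic projections.
[cite: GortzWedhorn2020, Prop. 13.91] [cite: Liu2002, Thm. 8.1.19] [cite: Matsumura1987, Thm. 14.2]
-/

set_option linter.dupNamespace false -- mandated namespace `Summit.<Summit>.<Problem>` of this single-conjunct summit
set_option linter.overlappingInstances false -- signatures carry `[IsDomain O] [IsDiscreteValuationRing O]`

noncomputable section

open CategoryTheory CategoryTheory.Limits AlgebraicGeometry TopologicalSpace Topology IsLocalRing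
open Literature.AlgebraicGeometry.Resolution
open AlgebraicGeometry.Scheme.IdealSheafData

namespace Summit.ResolutionOfSingularities.ResolutionOfSingularities.Cruxes.EquisingularLiftNat.Sections.TCPlus

variable (O : Type) [CommRing O] [IsDomain O] [IsDiscreteValuationRing O] (k : Type) [Field k] (θ : O →+* k)
  (P : Scheme.{0}) (q : P ⟶ Spec (.of O)) (Y : Set P) (Ch : ∀ X' : Scheme.{0}, (X' ⟶ P) → Set X' → Prop)

/-- **`TCPlus.MemberS₀At` — the body of `TCPlus.MemberS₀` at an EXPLICIT upstairs stage `(X, σ, S, jG, tG, 𝓢, K)`** (clauses (i)–(vi), (viii), (ix), (x)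
verbatim; no shadow clause). [OURS · L1 W4.5b · T23-A‴ (U6), shadow-free arm] -/
def MemberS₀At (G : Scheme.{0}) (T Z Sd : Set G) (excl : Set G) (X : Scheme.{0}) (σ : X ⟶ P) (S : Set X) (jG : G ⟶ X)
    (tG : G ⟶ Spec (.of k)) (𝓢 K : X.IdealSheafData) : Prop :=
    Ch X σ S ∧ IsIntegral X ∧ IsLocallyNoetherian X ∧ Scheme.IsRegular X ∧ IsDominant (σ ≫ q) ∧
    IsPullback jG tG (σ ≫ q) (Spec.map (CommRingCat.ofHom θ)) ∧ jG '' T = S ∧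
    -- (i) exact special fibre
    (𝓢 ⊔ K).comap jG = vanishingIdeal (⟨closure Z, isClosed_closure⟩ : Closeds G) ∧
    -- (ii) flat over `O`
    Flat ((𝓢 ⊔ K).subschemeι ≫ σ ≫ q) ∧
    -- (iii) the carrier is regular, both ideal sheaves are locally principal
    Scheme.IsRegular 𝓢.subscheme ∧ (∀ z : X, (stalkIdeal 𝓢 z).IsPrincipal ∧ (stalkIdeal K z).IsPrincipal) ∧
    -- (iv) off the generic point of `Y`
    σ '' ((𝓢 ⊔ K).support : Set X) ⊆ {y : P | ¬ IsGenericPoint y Y} ∧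
    -- (v) regular quotient stalks at the special points, off the excluded ones — of codimension `2` at the closed ones
    (∀ z ∈ ((𝓢 ⊔ K).support : Set X), (σ ≫ q) z = closedPoint O → z ∉ jG '' excl →
      IsRegularLocalRing (X.presheaf.stalk z ⧸ stalkIdeal (𝓢 ⊔ K) z) ∧
      (IsClosed ({z} : Set X) →
        ringKrullDim (X.presheaf.stalk z ⧸ stalkIdeal (𝓢 ⊔ K) z) + 2 = ringKrullDim (X.presheaf.stalk z))) ∧
    -- (vi) centred packages at the excluded points
    (∀ y₀ ∈ excl, CentredPackage O P q X σ 𝓢 K (jG y₀)) ∧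
    -- (viii) the carrier cuts an effective Cartier divisor on the cone (NO shadow clause (vii) in this arm)
    IsEffectiveCartier (𝓢.comap K.subschemeι) ∧
    -- (ix) THE PLANE TRACE: the carrier's special fibre is the reduced downstairs plane
    𝓢.comap jG = vanishingIdeal (⟨closure Sd, isClosed_closure⟩ : Closeds G) ∧
    -- (x) the plane's model is flat over `O` ON ITS OWN (the seeded member's `FE` datum)
    Flat (𝓢.subschemeι ≫ σ ≫ q)

/-- `MemberS₀` is `∃ stage, MemberS₀At` — by `rfl`. [OURS · pure logic] -/
theorem memberS₀_iff {G : Scheme.{0}} {T Z Sd excl : Set G} :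
    MemberS₀ O k θ P q Y Ch G T Z Sd excl ↔
      ∃ (X : Scheme.{0}) (σ : X ⟶ P) (S : Set X) (jG : G ⟶ X) (tG : G ⟶ Spec (.of k)) (𝓢 K : X.IdealSheafData),
        MemberS₀At O k θ P q Y Ch G T Z Sd excl X σ S jG tG 𝓢 K :=
  Iff.rfl

/-- `MemberSAt ⇒ MemberS₀At` at the SAME stage (forget the shadow clause (vii-loc)). [OURS · pure logic] -/
theorem memberSAt_memberS₀At {G : Scheme.{0}} {T Z Kd Sd excl : Set G} {X : Scheme.{0}} {σ : X ⟶ P} {S : Set X} {jG : G ⟶ X}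
    {tG : G ⟶ Spec (.of k)} {𝓢 K : X.IdealSheafData} (h : MemberSAt O k θ P q Y Ch G T Z Kd Sd excl X σ S jG tG 𝓢 K) :
    MemberS₀At O k θ P q Y Ch G T Z Sd excl X σ S jG tG 𝓢 K := by
  obtain ⟨hCh, hXint, hXnoeth, hXreg, hdom, hsq, hTS, hi, hii, hiii, hiiip, hiv, hv, hvi, -, hviii, hix, hx⟩ := h
  exact ⟨hCh, hXint, hXnoeth, hXreg, hdom, hsq, hTS, hi, hii, hiii, hiiip, hiv, hv, hvi, hviii, hix, hx⟩

/-- **`TCPlus.MemberS₀L` — a `MemberS₀` carrying a LIST `Ls` of model-carrying in-carrier planes IN THE SAME STAGE.** [OURS · L1 W4.5b · T23-A‴ (U6)] -/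
def MemberS₀L (G : Scheme.{0}) (T Z Sd : Set G) (Ls : List (Set G)) (excl : Set G) : Prop :=
  ∃ (X : Scheme.{0}) (σ : X ⟶ P) (S : Set X) (jG : G ⟶ X) (tG : G ⟶ Spec (.of k)) (𝓢 K : X.IdealSheafData),
    MemberS₀At O k θ P q Y Ch G T Z Sd excl X σ S jG tG 𝓢 K ∧ ∀ L ∈ Ls, LetterDatum O P q Y G X σ jG L

/-- **`TCPlus.InvS₀L` — `InvS₀` with the plane list threaded** (`INV W G β T Z S_d Ls b`). [OURS · L1 W4.5b · T23-A‴ (U6)] -/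
def InvS₀L {F₁ F₂ : Scheme.{0}} (_W : Set F₁) (G : Scheme.{0}) (_β : G ⟶ F₂) (T Z Sd : Set G) (Ls : List (Set G)) (b : Bool) : Prop :=
  IsIntegral G ∧ IsClosed T ∧ IsIrreducible T ∧ ¬ T ⊆ closure Z ∧ MemberS₀L O k θ P q Y Ch G T Z Sd Ls ∅ ∧
    (b = false → ∀ y : ↥(vanishingIdeal (⟨closure Z, isClosed_closure⟩ : Closeds G)).subscheme,
      IsClosed ({((vanishingIdeal (⟨closure Z, isClosed_closure⟩ : Closeds G)).subschemeι y : G)} : Set G) →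
      ¬ IsRegularLocalRing ((vanishingIdeal (⟨closure Z, isClosed_closure⟩ : Closeds G)).subscheme.presheaf.stalk y) →
      MemberS₀L O k θ P q Y Ch G T Z Sd Ls {((vanishingIdeal (⟨closure Z, isClosed_closure⟩ : Closeds G)).subschemeι y : G)})

/-! ## Pure-logic projections -/

/-- `MemberS₀L ⇒ MemberS₀` (forget the letters). [OURS · pure logic] -/
theorem memberS₀L_memberS₀ {G : Scheme.{0}} {T Z Sd excl : Set G} {Ls : List (Set G)} (h : MemberS₀L O k θ P q Y Ch G T Z Sd Ls excl) :
    MemberS₀ O k θ P q Y Ch G T Z Sd excl := by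
  obtain ⟨X, σ, S, jG, tG, 𝓢, K, hAt, -⟩ := h
  exact ⟨X, σ, S, jG, tG, 𝓢, K, hAt⟩

/-- `MemberS₀ ⇒ MemberS₀L` with the EMPTY plane list. [OURS · pure logic] -/
theorem memberS₀L_nil_of_memberS₀ {G : Scheme.{0}} {T Z Sd excl : Set G} (h : MemberS₀ O k θ P q Y Ch G T Z Sd excl) :
    MemberS₀L O k θ P q Y Ch G T Z Sd [] excl := by
  obtain ⟨X, σ, S, jG, tG, 𝓢, K, hAt⟩ := h
  exact ⟨X, σ, S, jG, tG, 𝓢, K, hAt, fun L hL => by simp at hL⟩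

/-- Dropping letters. [OURS · pure logic] -/
theorem memberS₀L_of_sublist {G : Scheme.{0}} {T Z Sd excl : Set G} {Ls Ls' : List (Set G)} (h : MemberS₀L O k θ P q Y Ch G T Z Sd Ls excl)
    (hsub : ∀ L ∈ Ls', L ∈ Ls) : MemberS₀L O k θ P q Y Ch G T Z Sd Ls' excl := by
  obtain ⟨X, σ, S, jG, tG, 𝓢, K, hAt, hL⟩ := h
  exact ⟨X, σ, S, jG, tG, 𝓢, K, hAt, fun L hL' => hL L (hsub L hL')⟩

/-- The letters' data, for the record: every letter has a model with reduced trace in SOME realisation of the member. [OURS · pure logic] -/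
theorem memberS₀L_letters {G : Scheme.{0}} {T Z Sd excl : Set G} {Ls : List (Set G)} (h : MemberS₀L O k θ P q Y Ch G T Z Sd Ls excl) :
    ∃ (X : Scheme.{0}) (σ : X ⟶ P) (jG : G ⟶ X) (tG : G ⟶ Spec (.of k)),
      IsPullback jG tG (σ ≫ q) (Spec.map (CommRingCat.ofHom θ)) ∧ ∀ L ∈ Ls, LetterDatum O P q Y G X σ jG L := by
  obtain ⟨X, σ, S, jG, tG, 𝓢, K, ⟨-, -, -, -, -, hsq, -⟩, hL⟩ := h
  exact ⟨X, σ, jG, tG, hsq, hL⟩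

/-- `InvS₀L ⇒ InvS₀`. [OURS · pure logic] -/
theorem invS₀L_invS₀ {F₁ F₂ : Scheme.{0}} {W : Set F₁} {G : Scheme.{0}} {β : G ⟶ F₂} {T Z Sd : Set G} {Ls : List (Set G)} {b : Bool}
    (h : InvS₀L O k θ P q Y Ch W G β T Z Sd Ls b) : InvS₀ O k θ P q Y Ch W G β T Z Sd b := by
  obtain ⟨hG, hT, hTirr, hTZ, hmem, hcen⟩ := h
  exact ⟨hG, hT, hTirr, hTZ, memberS₀L_memberS₀ O k θ P q Y Ch hmem, fun hb y hy hreg => memberS₀L_memberS₀ O k θ P q Y Ch (hcen hb y hy hreg)⟩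

/-- `InvS₀ ⇒ InvS₀L` with the empty plane list. [OURS · pure logic] -/
theorem invS₀L_nil_of_invS₀ {F₁ F₂ : Scheme.{0}} {W : Set F₁} {G : Scheme.{0}} {β : G ⟶ F₂} {T Z Sd : Set G} {b : Bool}
    (h : InvS₀ O k θ P q Y Ch W G β T Z Sd b) : InvS₀L O k θ P q Y Ch W G β T Z Sd [] b := by
  obtain ⟨hG, hT, hTirr, hTZ, hmem, hcen⟩ := h
  exact ⟨hG, hT, hTirr, hTZ, memberS₀L_nil_of_memberS₀ O k θ P q Y Ch hmem,
    fun hb y hy hreg => memberS₀L_nil_of_memberS₀ O k θ P q Y Ch (hcen hb y hy hreg)⟩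

/-- Dropping letters in `InvS₀L`. [OURS · pure logic] -/
theorem invS₀L_of_sublist {F₁ F₂ : Scheme.{0}} {W : Set F₁} {G : Scheme.{0}} {β : G ⟶ F₂} {T Z Sd : Set G} {Ls Ls' : List (Set G)}
    {b : Bool} (h : InvS₀L O k θ P q Y Ch W G β T Z Sd Ls b) (hsub : ∀ L ∈ Ls', L ∈ Ls) :
    InvS₀L O k θ P q Y Ch W G β T Z Sd Ls' b := by
  obtain ⟨hG, hT, hTirr, hTZ, hmem, hcen⟩ := h
  exact ⟨hG, hT, hTirr, hTZ, memberS₀L_of_sublist O k θ P q Y Ch hmem hsub,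
    fun hb y hy hreg => memberS₀L_of_sublist O k θ P q Y Ch (hcen hb y hy hreg) hsub⟩

/-- `MemberSL ⇒ MemberS₀L` (same stage, same planes; forget the shadow). [OURS · pure logic] -/
theorem memberSL_memberS₀L {G : Scheme.{0}} {T Z Kd Sd excl : Set G} {Ls : List (Set G)} (h : MemberSL O k θ P q Y Ch G T Z Kd Sd Ls excl) :
    MemberS₀L O k θ P q Y Ch G T Z Sd Ls excl := by
  obtain ⟨X, σ, S, jG, tG, 𝓢, K, hAt, hL⟩ := h
  exact ⟨X, σ, S, jG, tG, 𝓢, K, memberSAt_memberS₀At O k θ P q Y Ch hAt, hL⟩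

/-- `InvSL ⇒ InvS₀L` (forget the shadow, keep the planes). [OURS · pure logic] -/
theorem invSL_invS₀L {F₁ F₂ : Scheme.{0}} {W : Set F₁} {G : Scheme.{0}} {β : G ⟶ F₂} {T Z Kd Sd : Set G} {Ls : List (Set G)} {b : Bool}
    (h : InvSL O k θ P q Y Ch W G β T Z Kd Sd Ls b) : InvS₀L O k θ P q Y Ch W G β T Z Sd Ls b := by
  obtain ⟨hG, hT, hTirr, hTZ, hmem, hcen⟩ := h
  exact ⟨hG, hT, hTirr, hTZ, memberSL_memberS₀L O k θ P q Y Ch hmem, fun hb y hy hreg => memberSL_memberS₀L O k θ P q Y Ch (hcen hb y hy hreg)⟩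

/-- The uncentred member with letters, read off `InvS₀L`. [OURS · pure logic] -/
theorem invS₀L_memberS₀L {F₁ F₂ : Scheme.{0}} {W : Set F₁} {G : Scheme.{0}} {β : G ⟶ F₂} {T Z Sd : Set G} {Ls : List (Set G)} {b : Bool}
    (h : InvS₀L O k θ P q Y Ch W G β T Z Sd Ls b) : MemberS₀L O k θ P q Y Ch G T Z Sd Ls ∅ :=
  h.2.2.2.2.1

end Summit.ResolutionOfSingularities.ResolutionOfSingularities.Cruxes.EquisingularLiftNat.Sections.TCPlus

end
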